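import Summits.HodgeConjecture.HodgeConjecture.Theorems.F0P6aStubGENZip
import HarnessLib

/-!
# `F0P6aStubGEN` — ★ RE-HOME of `Lines/F0_P6a_StubGEN.lean`, PART 2 of 2 (size-lint split; cut at a declaration boundary).

## Import provenance
- `Theorems.F0P6aStubGENZip` = ★ previous part of the same `Lines` workfile `F0_P6a_StubGEN` (size-lint split ×2); `HarnessLib`.

See PART 1 `Theorems/F0P6aStubGENZip.lean` for the full re-home header and the original module docstring (verbatim there). Namespaces and sections KEPT
(re-opened below exactly as they stand at the cut, with their `open`∕`variable` lines replayed); code bytes = the workfile՚s, docstrings included; options preamble repeated from PART 1.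
HC_CM is proved only modulo the 7 printed citations (2 remaining: hLiu418 = stmt-HodgeConjecture-24832, h413 = stmt-HodgeConjecture-24833) until rung 0 closes; a re-home is count-neutral. -/

set_option autoImplicit false

noncomputable section

namespace Summit.HodgeConjecture.HodgeConjecture.Cruxes.HLiu418.F0P6aStubGEN
set_option linter.dupNamespace false  -- `Summit.HodgeConjecture.HodgeConjecture.…` BY DESIGN (D-0017)
open CategoryTheory CategoryTheory.Limits NumberField IsDedekindDomain MulAction
open scoped Matrix Polynomial Pointwise
open Literature.NumberTheory.GaloisRepresentations
open Literature.NumberTheory.Automorphic Literature.NumberTheory.Automorphic.UnitaryGroup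
open Literature.AlgebraicGeometry.ShimuraVarieties.UnitaryCanonicalModel
open Literature.NumberTheory.Automorphic.Liu2021.AppendixC
open Literature.AlgebraicGeometry.Motives (AlgPoints IntegralModel SchemeOver thickening thickeningGalAction thickeningLift)
open Literature.NumberTheory.DiophantineGeometry (geomResidueField specialFibreFunctor)
open Literature.AlgebraicGeometry.RelativeSpec (ActionOver)
open Literature.NumberTheory.EllipticCurves (genericFibre)
open AlgebraicGeometry (QuasiCompact QuasiSeparated LocallyOfFinitePresentation Flat IsSeparated)
open Summit.HodgeConjecture.HodgeConjecture.Cruxes.HLiu418.F0P6aModuliDatumDefs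
open Summit.HodgeConjecture.HodgeConjecture.Cruxes.HLiu418.F0P6aRGDAssembly
open Summit.HodgeConjecture.HodgeConjecture.Cruxes.HLiu418.F0P6aPELWitnessE (PELWitnessE IsCMTypeThrough mOf)
open Summit.HodgeConjecture.HodgeConjecture.Cruxes.HLiu418.F0P6aStubKOTT (KottAdaptedAt UnmixedAt)
open Summit.HodgeConjecture.HodgeConjecture.Cruxes.HLiu418.F0P6aPELInputs
open Summit.HodgeConjecture.HodgeConjecture.Cruxes.HLiu418.F0P6aPELSpread (RecordPELELawsCofinal)
open Summit.HodgeConjecture.HodgeConjecture.Cruxes.HLiu418.F0P6aEReadings (EHeckeAt ETwistKerAt heckeRoofsΩ_of_gen_iso coverΩ_of_gen_iso coverKerΩ_of_gen_iso)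
open Summit.HodgeConjecture.HodgeConjecture.Theorems.F0P6aKottwitzCountAtSplitPlace (exists_restrict)
open Summit.HodgeConjecture.HodgeConjecture.Theorems.F0P6aKottwitzAtOmegaOfComplexPoints (exists_ringHom_comp_eq)


/-- **`stub_GEN` — GEN՚S CHOICES WITH THE E-SIDE LAWS OF THE CHOSEN WITNESSES, IN E-CURRENCY** (LOAD-BEARING; size L; ★ parents: GEN O1–O4 (neat small level with
surjection `φ`, slice field = compositum of the E-line՚s `Fᵢ₀(Φ, Kc)`, integral model of the thickened curve, the hyperspecial∕split cofinality, `hdisj` ★ INT-RES∕GEO-PKG),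
KOTT ED. 2 `exists_adapted_unmixed_frame`; E-side: the E-line head `pelWitnessE_of_line` per frame + its FUTURE exports (S-E) point separation, (H-E) Hecke roofs, (T-E)
twist∕kernel readings of the exported witness — TRUE of the honest witness (universal family pulled back along an injective `ε`, Shimura–Taniyama on its CM sheets), FALSE
for a junk `E`, which is why the laws are existentially tied to the choice).  Why it might fail: only if the E-line cannot export (H-E)∕(T-E) in this currency at
cofinitely many `w` for ONE witness per frame over a COMMON slice field and level — the letter lets `S_G` absorb every finite exceptional set and lets the level shrink
below `K`.  **PAID (ED. 2)** by the GEN zip `gen_of_parts′` (§2b) on the X-leaf head `F0P6aEExports.eLaws_of_frames` BY NAME — no `sorry` in this leaf; its axioms are the X-leaf՚s.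
[cite: RapoportSmithlingZhang2020Diagonal, §4.1 Thm. 4.1 p. 17] [cite: Deligne1971TravauxShimura, 4.16 p. 150] [cite: Liu2021, Lemma C.18 p. 115, Prop. D.8 p. 135]
[cite: Shimura1998, §18.6 Thm. 18.6 pp. 124–125; §13.1 Thm. 1 pp. 97–99] -/
theorem stub_GEN : RecordGENChoicesCofinal :=
  gen_of_parts' F0P6aEExports.eLaws_of_frames

/-! ### §4 The transport along a spread՚s provenance and THE ZIP -/

/-- **`eLaws_of_provenance`** — the three E-currency laws of a witness `E′` pass to the witness `T.E` of a spread whose PROVENANCE is `E′`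
(`T.τE = τ′`, `T.Φ = Φ′`, `HEq T.E E′`): `subst` the two equations (their right-hand sides are variables), then the `HEq` is homogeneous and `cases` closes it.
Pure logic. [cite: RapoportSmithlingZhang2020Diagonal, §4.1 Thm. 4.1 p. 17] -/
theorem eLaws_of_provenance {F : Type} [Field F] [NumberField F] [IsCMField F] {ι₁ : F →+* ℂ}
    {Jstar : Matrix (Fin 2) (Fin 2) F}
    {K₀ : C5.OpenCompactSubgroup ↥(finAdelic ↥(maximalRealSubfield F) F (IsCMField.complexConj F) 2 Jstar)}
    {S : RecordSystemGS F Jstar ι₁ K₀} {hU7ₛ : S.HeckeTranslateDefinedOver}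
    {hJ : (Jstar.map (IsCMField.complexConj F))ᵀ = Jstar} {hJu : IsUnit Jstar}
    {Fi : Type} [Field Fi] [NumberField Fi] [Algebra F Fi] {Kc : C5.SmallLevel K₀} {G : Type} [Group G]
    {𝓜 : IntegralModel (𝓞 F) F ((thickening F Fi).obj (S.M.obj Kc))}
    {w : HeightOneSpectrum (𝓞 F)} {hw : (IsCMField.complexConj F) • w ≠ w} {h𝓨 : (𝓜.localise w).IsSmoothProper 1}
    {θ : ActionOver (𝓜.localise w).total.hom ((Fi ≃ₐ[F] Fi) × G)}
    {e : Fi →ₐ[F] AlgebraicClosure (w.adicCompletion F)}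
    (T : PELSpreadAt F ι₁ Jstar K₀ S hU7ₛ hJ hJu Fi Kc G 𝓜 w hw h𝓨 θ e)
    {τ' : Fi →+* ℂ} {Φ' : Set (F →+* ℂ)} {E' : PELWitnessE F ι₁ Jstar K₀ S Kc Fi τ' Φ'}
    (hτ : T.τE = τ') (hΦ : T.Φ = Φ') (hE : HEq T.E E')
    (hsep : ESepAt S Kc w E') (hhecke : EHeckeAt S hU7ₛ hJ hJu Kc w hw E' T.pChar T.fDeg)
    (htwist : ETwistKerAt S Kc w e E' T.pChar T.fDeg) :
    ESepAt S Kc w T.E ∧ EHeckeAt S hU7ₛ hJ hJu Kc w hw T.E T.pChar T.fDeg ∧ ETwistKerAt S Kc w e T.E T.pChar T.fDeg := by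
  subst hτ hΦ
  cases hE
  exact ⟨hsep, hhecke, htwist⟩

/-- **THE ZIP `elaws_of_parts (hGEN) (hH) (hT) : RecordPELELawsCofinal`** — SORRY-FREE: GEN՚s ∃-block of `hGEN` PEELED by `Exists.elim` (B-p18 (g38) profile —
never a 30-pattern `obtain` against the letter-sized goal) and re-packed unchanged (`S_L := S_G`); at `w ∉ S_G`: the hyperspecial passage and the index `i` from
`hGEN`; under `h𝓨 θ hθ e`: `hdisj` from `hGEN`; for a spread `T` of provenance `(τE, Φf i, Ef i)`: the guarded E-laws of `hGEN` at `(T.pChar, T.fDeg)` by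
`T.hpChar.1 T.hpChar.2 T.hfDeg`, transported to `T.E` by `eLaws_of_provenance`, then `ESepAt` as is, `PELHeckeLawAt T := hH … T ‹EHeckeAt›`,
`PELTwistLawAt T := hT … T ‹ETwistKerAt at e›`.  The instance of record: §6 `elaws_of_line := elaws_of_parts stub_GEN heckeZip_holds twistZip_holds` (desk plan (A1); under plan (B) the leaf ED. 2 would write `stub_ELAWS := elaws_of_parts stub_GEN stub_HECKE stub_TWIST`).
[cite: RapoportSmithlingZhang2020Diagonal, §4.1 Thm. 4.1 p. 17] [cite: Kottwitz1992, §5 pp. 389–391] -/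
theorem elaws_of_parts (hGEN : RecordGENChoicesCofinal) (hH : RecordHeckeZip) (hT : RecordTwistZip) :
    RecordPELELawsCofinal := by
  intro F _ _ _ _ ι₁ Jstar K₀ S hU7ₛ hJ hJu K
  refine (hGEN F ι₁ Jstar K₀ S hU7ₛ hJ hJu K).elim fun Fi h => h.elim fun iF h => h.elim fun iNF h =>
    h.elim fun iA h => h.elim fun iFD h => h.elim fun iG h => h.elim fun Kc h => h.elim fun hKcK h => h.elim fun hn h =>
    h.elim fun G h => h.elim fun iGr h => h.elim fun iFin h => h.elim fun φ h => h.elim fun hφ h => h.elim fun hφker h =>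
    h.elim fun 𝓜 h => h.elim fun i1 h => h.elim fun i2 h => h.elim fun i3 h => h.elim fun i4 h => h.elim fun i5 h =>
    h.elim fun ιdx h => h.elim fun iι h => h.elim fun Φf h => h.elim fun hΦf h => h.elim fun τE h => h.elim fun hτE h =>
    h.elim fun Ef h => h.elim fun S_G h => ?_
  refine ⟨Fi, iF, iNF, iA, iFD, iG, Kc, hKcK, hn, G, iGr, iFin, φ, hφ, hφker, 𝓜, i1, i2, i3, i4, i5,
    ιdx, iι, Φf, hΦf, τE, hτE, Ef, S_G, h.1, ?_⟩
  intro w hwS hw hunit hK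
  have hKw := h.2 w hwS hw hunit hK
  refine ⟨hKw.1, ?_⟩
  refine hKw.2.elim fun i hi => ⟨i, hi.1, hi.2.1, fun h𝓨 θ hθ e => ⟨hi.2.2.2.2 h𝓨 θ hθ e, fun T hτ hΦ hE => ?_⟩⟩
  -- the E-laws of the chosen witness at the arithmetic of `w` carried by `T`, transported along the provenance of `T`
  have hl := hi.2.2.2.1 T.pChar T.fDeg T.hpChar.1 T.hpChar.2 T.hfDeg
  have h3 := eLaws_of_provenance T hτ hΦ hE hi.2.2.1 hl.1 (hl.2 e)
  exact ⟨h3.1, hH F ι₁ Jstar K₀ S hU7ₛ hJ hJu Fi Kc G 𝓜 w hw h𝓨 θ e T h3.2.1,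
    hT F ι₁ Jstar K₀ S hU7ₛ hJ hJu Fi Kc G 𝓜 w hw h𝓨 θ e T h3.2.2⟩

/-! ### §5 THE PAYERS: the Hecke zip (E-READINGS `heckeRoofsΩ_of_gen_iso`; = LA4-p02 (g0) §0d `pelHeckeLawAt_of_eHeckeAt`), the row-(7) payer (LA4-p04 (g0) 579af007 VERBATIM), the twist zip (LA4-p02 (g0) §0d VERBATIM over the P-LINE ED. 2 §0c hoist) -/

/-- **`heckeZip_holds : RecordHeckeZip`** — one line: `PELHeckeLawAt … T` unfolds to `HeckeRoofsΩ … T.univ T.act T.dual T.pol T.lvl T.pChar T.fDeg`, which is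
`heckeRoofsΩ_of_gen_iso` at the provenance `T.gen_iso` (`genIncl` = the inlined `ι_η` by `rfl`) fed with `EHeckeAt … T.E …` (= `HeckeRoofsE` of the E-tuple).
Axioms TRIO ∪ {sorryAx} through the E-READINGS socket `stub_HECKETRANS` only (a registered transport stub; LA4-p02 ★ cand `F0P6aHeckeRoofsTransport`).
[cite: Kottwitz1992, §5 pp. 389–391] [cite: RapoportSmithlingZhang2020Diagonal, §4.1 p. 17, §4.3 (4.23) p. 21] -/
theorem heckeZip_holds : RecordHeckeZip := by
  intro F _ _ _ ι₁ Jstar K₀ S hU7ₛ hJ hJu Fi _ _ _ Kc G _ 𝓜 w hw h𝓨 θ e T h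
  exact heckeRoofsΩ_of_gen_iso S hU7ₛ hJ hJu Kc 𝓜 w hw T.univ T.act T.dual T.pol T.lvl T.E.P.A T.E.ρ T.E.P.D T.E.P.pol T.E.P.level
    T.gen_iso T.pChar T.fDeg h

open scoped MonObj Obj in
/-- **ROW (7) ∕ (π2-G) `frobKernel_banal` PAID: `FrobKernelBanal₀ … T.univ T.act T.pChar T.fDeg 𝔞` for `𝔞 = 𝔞_can(m, τR, w)`** — for every spread-with-provenance
`T : PELSpreadAt …` and every explicit Kottwitz package `(m, τR)` on it (`τR_spec`, the count `∑_{τ ↦ c•w} m τ = 1`, `KottwitzΩ … T.univ T.act m`, `m_pair`,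
`m_banal`, `m_unmixed` — the six conjuncts of `PELKottLawAt T` BEFORE the `∃` is packed, as `stub_KOTT` holds them for `m := mOf ι₁ T.Φ (σ₀ ∘ ·)`), the
banal-block Frobenius-kernel law holds at the canonical twist ideal `∏_{τ : m τ ≠ 0, τ ∤ c•w} ker (residue ∘ τR τ)` (★ p847883 token) at EVERY record point —
one `fun … =>` over ★ LA4-p04 `frobKernelBanal_canTwistIdeal` (p848302) at `x̄ := red₀Of … y` (δ-unfolding of `sch₀Of`∕`act₀Of`∕`red₀Of`), fed by the rows of `T`
(`relDim rosati dual pol polQuasiInv pChar hpChar fDeg hfDeg charP₀`; `0 < fDeg` from `hfDeg`: `#(𝓞 F ⧸ 𝔭) = N𝔭 ≠ 1`).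
[cite: Shimura1998, §13.1 Thm. 1 (pp. 97–99); §18.6 (p. 127)] [cite: RapoportSmithlingZhang2020Diagonal, §4.1 (4.6) p. 16 and p. 17] [cite: Kottwitz1992, §5 (pp. 389–391)] -/
theorem frobKernelBanal₀_of_kottRows {F : Type} [Field F] [NumberField F] [IsCMField F] [IsGalois ℚ F] {ι₁ : F →+* ℂ}
    {Jstar : Matrix (Fin 2) (Fin 2) F}
    {K₀ : C5.OpenCompactSubgroup ↥(finAdelic ↥(maximalRealSubfield F) F (IsCMField.complexConj F) 2 Jstar)}
    {S : RecordSystemGS F Jstar ι₁ K₀} {hU7ₛ : S.HeckeTranslateDefinedOver}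
    {hJ : (Jstar.map (IsCMField.complexConj F))ᵀ = Jstar} {hJu : IsUnit Jstar}
    {Fi : Type} [Field Fi] [NumberField Fi] [Algebra F Fi] {Kc : C5.SmallLevel K₀} {G : Type} [Group G]
    {𝓜 : IntegralModel (𝓞 F) F ((thickening F Fi).obj (S.M.obj Kc))}
    {w : HeightOneSpectrum (𝓞 F)} {hw : (IsCMField.complexConj F) • w ≠ w} {h𝓨 : (𝓜.localise w).IsSmoothProper 1}
    {θ : ActionOver (𝓜.localise w).total.hom ((Fi ≃ₐ[F] Fi) × G)}
    {e : Fi →ₐ[F] AlgebraicClosure (w.adicCompletion F)}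
    (T : PELSpreadAt F ι₁ Jstar K₀ S hU7ₛ hJ hJu Fi Kc G 𝓜 w hw h𝓨 θ e)
    (m : (F →+* AlgebraicClosure (w.adicCompletion F)) → ℕ)
    (τR : (F →+* AlgebraicClosure (w.adicCompletion F)) → (𝓞 F →+* ↥(closureValuationSubring (w.adicCompletion F))))
    (hτR : ∀ (τ : F →+* AlgebraicClosure (w.adicCompletion F)) (x : 𝓞 F),
      ((τR τ x : ↥(closureValuationSubring (w.adicCompletion F))) : AlgebraicClosure (w.adicCompletion F)) = τ (x : F))
    (hcount : ∑ τ ∈ (Finset.univ.filter fun τ : F →+* AlgebraicClosure (w.adicCompletion F) =>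
        RingHom.ker ((IsLocalRing.residue ↥(closureValuationSubring (w.adicCompletion F))).comp (τR τ)) =
          (((IsCMField.complexConj F) • w).asIdeal : Ideal (𝓞 F))), m τ = 1)
    (hKΩ : KottwitzΩ S Kc 𝓜 w T.univ T.act m)
    (hpair : ∀ τ : F →+* AlgebraicClosure (w.adicCompletion F),
      m τ + m (τ.comp ((IsCMField.complexConj F : F ≃ₐ[↥(maximalRealSubfield F)] F) : F →+* F)) = 2)
    (hbanal : ∀ τ : F →+* AlgebraicClosure (w.adicCompletion F),
      RingHom.ker ((IsLocalRing.residue ↥(closureValuationSubring (w.adicCompletion F))).comp (τR τ)) ≠ (w.asIdeal : Ideal (𝓞 F)) →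
      RingHom.ker ((IsLocalRing.residue ↥(closureValuationSubring (w.adicCompletion F))).comp (τR τ)) ≠
        (((IsCMField.complexConj F) • w).asIdeal : Ideal (𝓞 F)) →
      m τ = 0 ∨ m τ = 2)
    (hunmixed : ∀ τ τ' : F →+* AlgebraicClosure (w.adicCompletion F),
      RingHom.ker ((IsLocalRing.residue ↥(closureValuationSubring (w.adicCompletion F))).comp (τR τ)) =
        RingHom.ker ((IsLocalRing.residue ↥(closureValuationSubring (w.adicCompletion F))).comp (τR τ')) →
      RingHom.ker ((IsLocalRing.residue ↥(closureValuationSubring (w.adicCompletion F))).comp (τR τ)) ≠ w.asIdeal →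
      RingHom.ker ((IsLocalRing.residue ↥(closureValuationSubring (w.adicCompletion F))).comp (τR τ)) ≠
        ((IsCMField.complexConj F) • w).asIdeal →
      m τ = m τ')
    {𝔞 : Ideal (𝓞 F)}
    (h𝔞 : 𝔞 = ∏ τ ∈ Finset.univ.filter (fun τ : F →+* AlgebraicClosure (w.adicCompletion F) =>
        m τ ≠ 0 ∧ RingHom.ker ((IsLocalRing.residue ↥(closureValuationSubring (w.adicCompletion F))).comp (τR τ)) ≠
          (((IsCMField.complexConj F) • w).asIdeal : Ideal (𝓞 F))),
      RingHom.ker ((IsLocalRing.residue ↥(closureValuationSubring (w.adicCompletion F))).comp (τR τ))) :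
    haveI : ExpChar (geomResidueField w) T.pChar := (haveI : CharP (geomResidueField w) T.pChar := T.charP₀; ExpChar.prime T.hpChar.1)
    FrobKernelBanal₀ S Kc 𝓜 w h𝓨 e T.univ T.act T.pChar T.fDeg 𝔞 := by
  subst h𝔞
  haveI : Fact T.pChar.Prime := ⟨T.hpChar.1⟩
  haveI : CharP (geomResidueField w) T.pChar := T.charP₀
  obtain ⟨d, ν, hν, hpd, hcomp⟩ := T.polQuasiInv
  haveI := hν
  -- `0 < f_w`: `#(𝓞 F ⧸ 𝔭_{c•w}) = N𝔭_{c•w} ≠ 1`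
  have hf : 0 < T.fDeg := by
    refine Nat.pos_of_ne_zero fun h0 => ((IsCMField.complexConj F) • w).isPrime.ne_top ?_
    rw [← Ideal.absNorm_eq_one_iff, Ideal.absNorm_apply, Submodule.cardQuot_apply, T.hfDeg, h0, pow_zero]
  exact fun y u hpu huw huc n _ t ht =>
    Summit.HodgeConjecture.HodgeConjecture.Theorems.F0P6aFrobKernelBanalAtCanonicalTwistIdeal.frobKernelBanal_canTwistIdeal hw (𝓜.localise w)
      h𝓨 T.relDim T.act T.dual T.pol T.rosati T.pChar hpd ν hcomp hf T.hfDeg m τR hτR hcount hKΩ hpair hbanal hunmixed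
      (red₀Of S Kc 𝓜 w h𝓨 e y) u hpu huw huc n t ht

/-- **(L5) `PELTwistLawAt … T` FROM THE E-LETTER `ETwistKerAt S Kc w e T.E T.pChar T.fDeg`** (E-READINGS ED. 2 §4): the twist data `(𝔞_γ, n_γ)` and the six arithmetic ∕
Frobenius rows pass unchanged; ROW (7) `FrobKernelBanal₀ … (𝔞_{γ_σ})` is the banal-block Frobenius-kernel law at the CANONICAL twist ideal of the explicit frame
signature `m₀ = mOf ι₁ T.Φ (σ₀ ∘ ·)` — the pin (FROB-can) rewrites `𝔞_{γ_σ} = 𝔞_can(m₀, τR, w)` and LA4-p04՚s `frobKernelBanal₀_of_kottRows` (★ p848302 ∕ p848099 ∕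
p848175) pays it from the five rows `kottRows_explicit T σ₀ hσ₀ τR hτR` (§0c); the Serre covers with and without kernel clause are the socket-paid transports
`coverKerΩ_of_gen_iso` ∕ `coverΩ_of_gen_iso` (LA4-p01 ★ p848359 ∕ p847952) at `T.gen_iso`. [cite: Shimura1998, §13.1 Thm. 1 (pp. 97–99); §18.6 Thm. 18.6 pp. 124–125]
[cite: RapoportSmithlingZhang2020Diagonal, §4.1 (4.6) p. 16 and p. 17; §3.2 p. 11; §4.3 p. 20] [cite: Kottwitz1992, §5 (pp. 389–391)] -/
theorem pelTwistLawAt_of_eTwistKerAt {F : Type} [Field F] [NumberField F] [IsCMField F] [IsGalois ℚ F] {ι₁ : F →+* ℂ}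
    {Jstar : Matrix (Fin 2) (Fin 2) F}
    {K₀ : C5.OpenCompactSubgroup ↥(finAdelic ↥(maximalRealSubfield F) F (IsCMField.complexConj F) 2 Jstar)}
    {S : RecordSystemGS F Jstar ι₁ K₀} {hU7ₛ : S.HeckeTranslateDefinedOver}
    {hJ : (Jstar.map (IsCMField.complexConj F))ᵀ = Jstar} {hJu : IsUnit Jstar}
    {Fi : Type} [Field Fi] [NumberField Fi] [Algebra F Fi] {Kc : C5.SmallLevel K₀} {G : Type} [Group G]
    {𝓜 : IntegralModel (𝓞 F) F ((thickening F Fi).obj (S.M.obj Kc))}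
    {w : HeightOneSpectrum (𝓞 F)} {hw : (IsCMField.complexConj F) • w ≠ w} {h𝓨 : (𝓜.localise w).IsSmoothProper 1}
    {θ : ActionOver (𝓜.localise w).total.hom ((Fi ≃ₐ[F] Fi) × G)}
    {e : Fi →ₐ[F] AlgebraicClosure (w.adicCompletion F)}
    (T : PELSpreadAt F ι₁ Jstar K₀ S hU7ₛ hJ hJu Fi Kc G 𝓜 w hw h𝓨 θ e)
    (h : ETwistKerAt S Kc w e T.E T.pChar T.fDeg) :
    PELTwistLawAt F ι₁ Jstar K₀ S hU7ₛ hJ hJu Fi Kc G 𝓜 w hw h𝓨 θ e T := by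
  obtain ⟨twistIdeal, twistNorm, hnorm, hcop, hne, hFa, hFn, hπ1, hpin, hK, hC⟩ := h
  -- `σ₀ : F̄_w →+* ℂ` over `ι₁` (★ p847344 §1 at `Fᵢ := F`) and the restrictions `τR` (★ p847313): ONE choice for every Frobenius reading
  obtain ⟨σ₀, hσ₀'⟩ := exists_ringHom_comp_eq F w F
    ((algebraMap (w.adicCompletion F) (AlgebraicClosure (w.adicCompletion F))).comp (algebraMap F (w.adicCompletion F))) ι₁
  have hσ₀ : σ₀.comp (algebraMap F (AlgebraicClosure (w.adicCompletion F))) = ι₁ := by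
    rw [IsScalarTower.algebraMap_eq F (w.adicCompletion F) (AlgebraicClosure (w.adicCompletion F))]; exact hσ₀'
  obtain ⟨τR, hτR⟩ := exists_restrict w
  obtain ⟨hcount, hKΩ, hpair, hbanal, hunmixed⟩ := kottRows_explicit T σ₀ hσ₀ τR hτR
  exact ⟨twistIdeal, twistNorm, hnorm, hcop, hne, hFa, hFn, hπ1,
    fun σ hσ γ hγ => frobKernelBanal₀_of_kottRows T (fun τ => mOf ι₁ T.Φ (σ₀.comp τ)) τR hτR hcount hKΩ hpair hbanal hunmixed
      (hpin σ₀ hσ₀ τR hτR σ hσ γ hγ),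
    fun e' γ y => coverKerΩ_of_gen_iso S Kc 𝓜 w T.univ T.act T.dual T.pol T.lvl T.E.P.A T.E.ρ T.E.P.D T.E.P.pol T.E.P.level
      T.gen_iso e' (e'.comp (γ : Fi →ₐ[F] Fi)) (twistIdeal γ) (twistNorm γ) y (hK e' γ y),
    fun e' γ y => coverΩ_of_gen_iso S Kc 𝓜 w T.univ T.act T.dual T.pol T.lvl T.E.P.A T.E.ρ T.E.P.D T.E.P.pol T.E.P.level
      T.gen_iso e' (e'.comp (γ : Fi →ₐ[F] Fi)) (twistIdeal γ) (twistNorm γ) y (hC e' γ y)⟩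

/-- **`twistZip_holds : RecordTwistZip`** — one line on `pelTwistLawAt_of_eTwistKerAt` (LA4-p02 (g0) §0d; cert e406e83a GREEN + TRIO by import).
[cite: Shimura1998, §18.6 Thm. 18.6 pp. 124–125; §13.1 Thm. 1 pp. 97–99] [cite: RapoportSmithlingZhang2020Diagonal, §3.2 p. 11, §4.3 p. 20] -/
theorem twistZip_holds : RecordTwistZip := by
  intro F _ _ _ _ ι₁ Jstar K₀ S hU7ₛ hJ hJu Fi _ _ _ Kc G _ 𝓜 w hw h𝓨 θ e T h
  exact pelTwistLawAt_of_eTwistKerAt T h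

/-! ### §6 THE HEAD -/

/-- **HEAD `elaws_of_line : type_of% @F0P6aPELSpread.stub_ELAWS`** (modulo the ONE socket `stub_GEN`; the two transport organs PAID) — `elaws_of_parts` AT
`stub_GEN heckeZip_holds twistZip_holds`; the future third argument of the leaf head at MAIN ED. 8
(`spread_of_parts ‹gspread› stub_INJ0 elaws_of_line`).  Sorry-free given the socket. [cite: RapoportSmithlingZhang2020Diagonal, §4.1 Thm. 4.1 p. 17] -/
theorem elaws_of_line : Summit.HodgeConjecture.HodgeConjecture.Cruxes.HLiu418.F0P6aPELSpread.RecordPELELawsCofinal :=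
  elaws_of_parts stub_GEN heckeZip_holds twistZip_holds

-- (ρ2) the SAME-STATEMENT TIE `example : @…F0P6aPELSpread.stub_ELAWS = @elaws_of_line := rfl` of tree :500–:501 lives HUB-SIDE in the `Lines/F0_P6a_StubGEN.lean` SHIM edition (LEAD F0P6-plan «M-145e»).

end Summit.HodgeConjecture.HodgeConjecture.Cruxes.HLiu418.F0P6aStubGEN

end
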